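import Literature.Probability.Percolation.Z2PivotalJointLimitTestFunctions
import Summits.CriticalPhenomena.CardyFormulaZ2.Theorems.CardyMeckeFlipFlipErgodicityZ2StubKernelExistsZ2OfLatticeAeAntitoneOfLimit

/-!
# Crux `FlipErgodicityZ2` (stmt-CriticalPhenomena-14825), line `registered`, stub
# `stub_jointKernelLimit`: node N1e tools — sandwich estimates in the cutoff

Route `Summits/CriticalPhenomena/CardyFormulaZ2/Theses/CardyMeckeFlip`.  Helper file (supports the
crux item).  Node N1e of the registered stub `stub_jointKernelLimit` (Garban–Pete–Schramm 2013
Thm. 4.3/§4.7 for bond-`ℤ²`) extends the joint graph convergence of a configuration with its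
averaged pivotal measures from countably many cutoffs to ALL real cutoffs by the almost sure
sandwich `μ^q_δ ≤ μ^{ε₀}_δ ≤ μ^{q'}_δ` (`q' ≤ ε₀ ≤ q`; the LANDED lattice antitonicity
`stub_latticePivotalAntitone`).  This file collects the tools:

* `z2PivotalMeasure_mono` — the lattice kernels are antitone in the cutoff AS MEASURES on
  lattice configurations (`δ ≤ ε' ≤ ε`);
* `abs_integral_sub_le_of_le_of_le` — for measures `m₂ ≤ m ≤ m₁` finite on compacts and
  `|φ| ≤ C χ`: `|∫ φ dm - ∫ φ dm₂| ≤ C (∫ χ dm₁ - ∫ χ dm₂)` (the sandwich estimate, used on the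
  lattice and in the limit);
* `ae_kernel_le_of_graphLimit` — the registered headline: the kernels of a joint graph limit on
  a countable cutoff set `A` (node N1abc) are almost surely antitone along `A` (the extension to
  `C_c` test functions `tendsto_jointLaw_z2PivotalMeasure_of_testFamily` feeds the landed limit
  passage `ae_kernel_le_of_jointLimit'`);
* `exists_antitone_version_of_ae_antitoneOn` — an everywhere-antitone measurable version of an
  a.s.-antitone family of kernels on a countable cutoff set, dominated by the given kernels;
* `integral_min_one_max_le`, `min_one_sum_le` — bookkeeping for the bounded gap functionals
  `min 1 (max 0 (C (U - L)))`;
* `exists_rat_tsub_lt_of_continuousAt`, `antitone_iSup_rat_gt` — at a continuity point `ε₀` of the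
  right-regularised antitone mean `ε ↦ ⨆_{q > ε} m q` there are rationals `q' < ε₀ < q` with
  `m q' - m q` small (the continuity input of the sandwich).
-/

noncomputable section

open MeasureTheory Set Filter Metric Function
open Literature.Probability.Percolation Literature.Probability.Percolation.QuadCrossing
open Literature.Probability.LatticeModels Literature.Probability.Distributions
open scoped ENNReal Topology BoundedContinuousFunction CompactlySupported

namespace Summit.CriticalPhenomena.CardyFormulaZ2.Theorems.CardyMeckeFlip

/-! ### The lattice kernels are antitone in the cutoff as measures -/

/-- **`μ^ε_δ(ω) ≤ μ^ε'_δ(ω)` as measures** for `0 < δ ≤ ε' ≤ ε` and a lattice configuration `ω`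
(edgewise, the landed `stub_latticePivotalAntitone`). [folklore] -/
theorem z2PivotalMeasure_mono {ε ε' δ : ℝ} (hδ : 0 < δ) (hδε' : δ ≤ ε') (hle : ε' ≤ ε)
    {ω : BondConfig (Site 2)} (hω : ω ⊆ (zdGraph 2).edgeSet) :
    z2PivotalMeasure ε δ ω ≤ z2PivotalMeasure ε' δ ω := by
  refine Measure.le_iff'.2 fun s => ?_
  rw [z2PivotalMeasure_apply, z2PivotalMeasure_apply]
  exact ENNReal.tsum_le_tsum fun p =>
    mul_le_mul' (stub_latticePivotalAntitone ε ε' δ hδ hδε' hle ω hω p.1 p.2) le_rfl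

/-! ### The sandwich estimate for integrals -/

/-- **Sandwich estimate.**  For measures `m₂ ≤ m ≤ m₁` on `ℂ` finite on compact sets,
`φ, χ` continuous with compact support, `χ ≥ 0`, `C ≥ 0` and `|φ| ≤ C χ` pointwise:
`|∫ φ dm - ∫ φ dm₂| ≤ C (∫ χ dm₁ - ∫ χ dm₂)` (apply monotonicity in the measure to the
non-negative functions `C χ ∓ φ`, then `∫ χ dm ≤ ∫ χ dm₁`). [folklore] -/
theorem abs_integral_sub_le_of_le_of_le {m m₁ m₂ : Measure ℂ} [IsFiniteMeasureOnCompacts m]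
    [IsFiniteMeasureOnCompacts m₁] [IsFiniteMeasureOnCompacts m₂] (h₂ : m₂ ≤ m) (h₁ : m ≤ m₁)
    {φ χ : ℂ → ℝ} (hφ : Continuous φ) (hφc : HasCompactSupport φ) (hχ : Continuous χ)
    (hχc : HasCompactSupport χ) (hχ0 : ∀ x, 0 ≤ χ x) {C : ℝ} (hC : 0 ≤ C)
    (hdom : ∀ x, |φ x| ≤ C * χ x) :
    |∫ x, φ x ∂m - ∫ x, φ x ∂m₂| ≤ C * (∫ x, χ x ∂m₁ - ∫ x, χ x ∂m₂) := by
  have hiφ : ∀ (ν : Measure ℂ) [IsFiniteMeasureOnCompacts ν], Integrable φ ν := fun ν _ =>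
    hφ.integrable_of_hasCompactSupport hφc
  have hiχ : ∀ (ν : Measure ℂ) [IsFiniteMeasureOnCompacts ν], Integrable χ ν := fun ν _ =>
    hχ.integrable_of_hasCompactSupport hχc
  -- `C χ - φ ≥ 0` and `C χ + φ ≥ 0`
  have hm : ∫ x, C * χ x - φ x ∂m₂ ≤ ∫ x, C * χ x - φ x ∂m :=
    integral_mono_measure h₂ (ae_of_all _ fun x => by
      have := (abs_le.1 (hdom x)).2; simp only [Pi.zero_apply]; linarith)
      (((hiχ m).const_mul C).sub (hiφ m))
  have hp : ∫ x, C * χ x + φ x ∂m₂ ≤ ∫ x, C * χ x + φ x ∂m :=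
    integral_mono_measure h₂ (ae_of_all _ fun x => by
      have := (abs_le.1 (hdom x)).1; simp only [Pi.zero_apply]; linarith)
      (((hiχ m).const_mul C).add (hiφ m))
  rw [integral_sub ((hiχ _).const_mul C) (hiφ _), integral_sub ((hiχ _).const_mul C) (hiφ _),
    integral_const_mul, integral_const_mul] at hm
  rw [integral_add ((hiχ _).const_mul C) (hiφ _), integral_add ((hiχ _).const_mul C) (hiφ _),
    integral_const_mul, integral_const_mul] at hp
  -- `∫ χ dm ≤ ∫ χ dm₁`
  have hχm : ∫ x, χ x ∂m ≤ ∫ x, χ x ∂m₁ :=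
    integral_mono_measure h₁ (ae_of_all _ fun x => hχ0 x) (hiχ m₁)
  have hCχ : C * ∫ x, χ x ∂m ≤ C * ∫ x, χ x ∂m₁ := mul_le_mul_of_nonneg_left hχm hC
  rw [abs_sub_le_iff]
  constructor <;> nlinarith

/-! ### Almost sure antitonicity of the kernels of a joint graph limit -/

/-- **The kernels of a joint graph limit are almost surely antitone in the cutoff.**  In the
setting of node N1abc (a mesh sequence `δ_k → 0⁺`, the uniform second moments (B2), a
dominated-dense test family `𝓓`, a set `A` of positive cutoffs and measurable kernels `M ε`
finite on compacts and locally `μ`-integrable on `A` with the joint graph convergence on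
`A × 𝓓`, `μ` a probability law on `ℋ`): for `ε' ≤ ε` in `A`, `M ε S ≤ M ε' S` for `μ`-a.e. `S`
(extension to `C_c` test functions, then the landed limit passage of the lattice antitonicity
`ae_kernel_le_of_jointLimit'`). [folklore] -/
theorem ae_kernel_le_of_graphLimit
    (hmom : ∀ ε : ℝ, 0 < ε → ∀ φ : ℂ → ℝ, Continuous φ → HasCompactSupport φ →
      ∃ C δ₀ : ℝ, 0 < δ₀ ∧ ∀ δ : ℝ, 0 < δ → δ ≤ δ₀ →
        ∫ ω, (∫ x, |φ x| ∂(z2PivotalMeasure ε δ ω)) ^ 2 ∂(bondPercolation (zdGraph 2) half) ≤ C)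
    (μ : FiniteMeasure (QuadConfig (univ : Set ℂ)))
    [IsProbabilityMeasure (μ : Measure (QuadConfig (univ : Set ℂ)))] {δs : ℕ → ℝ}
    (hpos : ∀ k, 0 < δs k) (h0 : Tendsto δs atTop (𝓝 0)) {𝓓 : Set C_c(ℂ, ℝ)}
    (hdense : ∀ K : Set ℂ, IsCompact K → ∃ χ ∈ 𝓓, (∀ x, χ x ∈ Icc (0 : ℝ) 1) ∧ (∀ x ∈ K, χ x = 1) ∧
      ∀ f : C_c(ℂ, ℝ), support f ⊆ K → ∀ η : ℝ, 0 < η → ∃ g ∈ 𝓓, ∀ x, |f x - g x| ≤ η * χ x)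
    {A : Set ℝ} (hApos : ∀ ε ∈ A, 0 < ε) {M : ℝ → QuadConfig (univ : Set ℂ) → Measure ℂ}
    (hMm : ∀ ε, Measurable (M ε)) (hMfin : ∀ ε S, IsFiniteMeasureOnCompacts (M ε S))
    (hMint : ∀ ε ∈ A, ∀ r : ℝ,
      ∫⁻ S, M ε S (closedBall 0 r) ∂(μ : Measure (QuadConfig (univ : Set ℂ))) < ⊤)
    (hG : ∀ G : (QuadConfig (univ : Set ℂ) × (A × 𝓓 → ℝ)) →ᵇ ℝ,
      Tendsto (fun k => ∫ ω, G (z2QuadConfig (univ : Set ℂ) (δs k) ω,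
          fun p => ∫ x, (p.2 : C_c(ℂ, ℝ)) x ∂(z2PivotalMeasure (p.1 : ℝ) (δs k) ω))
        ∂(bondPercolation (zdGraph 2) half)) atTop
        (𝓝 (∫ S, G (S, fun p => ∫ x, (p.2 : C_c(ℂ, ℝ)) x ∂(M (p.1 : ℝ) S))
          ∂(μ : Measure (QuadConfig (univ : Set ℂ))))))
    {ε ε' : ℝ} (hε : ε ∈ A) (hε' : ε' ∈ A) (hle : ε' ≤ ε) :
    ∀ᵐ S ∂(μ : Measure (QuadConfig (univ : Set ℂ))), M ε S ≤ M ε' S := by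
  refine ae_kernel_le_of_jointLimit' stub_latticePivotalAntitone μ M δs hpos h0 (hApos _ hε') hle
    (hMm ε) (hMm ε') (hMint ε hε) (hMint ε' hε') fun φ hφ hφc F => ?_
  have e1 : ∀ k ω, (![∫ x, φ x ∂(z2PivotalMeasure ε (δs k) ω),
      ∫ x, φ x ∂(z2PivotalMeasure ε' (δs k) ω)] : Fin 2 → ℝ) =
      fun j => ∫ x, φ x ∂(z2PivotalMeasure ((![ε, ε'] : Fin 2 → ℝ) j) (δs k) ω) := fun k ω => by
    funext j; fin_cases j <;> simp
  have e2 : ∀ S, (![∫ x, φ x ∂(M ε S), ∫ x, φ x ∂(M ε' S)] : Fin 2 → ℝ) =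
      fun j => ∫ x, φ x ∂(M ((![ε, ε'] : Fin 2 → ℝ) j) S) := fun S => by
    funext j; fin_cases j <;> simp
  simp_rw [e1, e2]
  exact tendsto_jointLaw_z2PivotalMeasure_of_testFamily hmom (μ : Measure (QuadConfig (univ : Set ℂ)))
    hpos h0 hdense hApos hMm hMfin hMint hG (εs := ![ε, ε'])
    (fun j => by fin_cases j <;> simp [hε, hε']) (φ := fun _ => φ) (fun _ => hφ) (fun _ => hφc) F

/-! ### Everywhere-antitone versions on a countable cutoff set -/

/-- **Antitone version of an a.s.-antitone family of kernels on a countable cutoff set.**  If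
`N d : X → Measure α` (`d ∈ D`, `D ⊆ ℝ` countable) are measurable and `N d' S ≤ N d S` a.s. for
`d ≤ d'` in `D`, then there is `M : ℝ → X → Measure α` with every `M ε` measurable, `ε ↦ M ε S`
antitone on `ℝ` for every `S`, `M ε S ≤ N d S` whenever `d ∈ D`, `d ≤ ε` (all `S`), and
`M d S = N d S` for all `d ∈ D`, for `μ`-a.e. `S` (the version lemma `exists_antitone_version`
on a measurable conull set where the countably many inequalities hold). [folklore] -/
theorem exists_antitone_version_of_ae_antitoneOn {X α : Type*} [MeasurableSpace X]
    [MeasurableSpace α] (μ : Measure X) {D : Set ℝ} (hD : D.Countable) (N : ℝ → X → Measure α)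
    (hN : ∀ d ∈ D, Measurable (N d))
    (hanti : ∀ d ∈ D, ∀ d' ∈ D, d ≤ d' → ∀ᵐ S ∂μ, N d' S ≤ N d S) :
    ∃ M : ℝ → X → Measure α, (∀ ε, Measurable (M ε)) ∧
      (∀ ε ε' : ℝ, ε' ≤ ε → ∀ S, M ε S ≤ M ε' S) ∧
      (∀ (S : X) (ε : ℝ), ∀ d ∈ D, d ≤ ε → M ε S ≤ N d S) ∧
      ∀ᵐ S ∂μ, ∀ d ∈ D, M d S = N d S := by
  have hae : ∀ᵐ S ∂μ, ∀ d ∈ D, ∀ d' ∈ D, d ≤ d' → N d' S ≤ N d S := by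
    refine (ae_ball_iff hD).2 fun d hd => (ae_ball_iff hD).2 fun d' hd' => ?_
    by_cases h : d ≤ d'
    · exact (hanti d hd d' hd' h).mono fun S hS _ => hS
    · exact ae_of_all _ fun S h' => absurd h' h
  rw [ae_iff] at hae
  obtain ⟨B, hsub, hBm, hB0⟩ := exists_measurable_superset_of_null hae
  have hgood : ∀ S ∈ Bᶜ, ∀ d ∈ D, ∀ d' ∈ D, d ≤ d' → N d' S ≤ N d S :=
    fun S hS => not_not.1 fun h => hS (hsub h)
  have hX₀ae : ∀ᵐ S ∂μ, S ∈ Bᶜ := compl_mem_ae_iff.2 hB0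
  obtain ⟨M, hMm, hMono, hMD, hMoff, -⟩ := exists_antitone_version hD N hN hBm.compl hgood
  refine ⟨M, hMm, hMono, fun S ε d hd hdε => ?_, hX₀ae.mono fun S hS d hd => hMD d hd S hS⟩
  by_cases hS : S ∈ Bᶜ
  · exact (hMono ε d hdε S).trans (hMD d hd S hS).le
  · rw [hMoff S hS ε]
    exact Measure.zero_le _

/-! ### Bounded gap functionals -/

/-- `min 1 (∑ᵢ fᵢ) ≤ ∑ᵢ min 1 fᵢ` for non-negative `fᵢ`. [folklore] -/
theorem min_one_sum_le {ι : Type*} (s : Finset ι) (f : ι → ℝ) (hf : ∀ i ∈ s, 0 ≤ f i) :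
    min 1 (∑ i ∈ s, f i) ≤ ∑ i ∈ s, min 1 (f i) := by
  classical
  -- `min 1 (a + b) ≤ min 1 a + min 1 b` for `a, b ≥ 0`
  have hadd : ∀ {a b : ℝ}, 0 ≤ a → 0 ≤ b → min 1 (a + b) ≤ min 1 a + min 1 b := by
    intro a b ha hb
    rcases le_total 1 a with h1 | h1
    · rw [min_eq_left h1]
      exact (min_le_left _ _).trans (le_add_of_nonneg_right (le_min zero_le_one hb))
    · rw [min_eq_right h1]
      rcases le_total 1 b with h2 | h2
      · rw [min_eq_left h2]
        exact (min_le_left _ _).trans (by linarith)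
      · rw [min_eq_right h2]
        exact min_le_right _ _
  induction s using Finset.induction_on with
  | empty => simp
  | @insert a s ha ih =>
    rw [Finset.sum_insert ha, Finset.sum_insert ha]
    have hfa : 0 ≤ f a := hf a (Finset.mem_insert_self a s)
    have hs : ∀ i ∈ s, 0 ≤ f i := fun i hi => hf i (Finset.mem_insert_of_mem hi)
    exact (hadd hfa (Finset.sum_nonneg hs)).trans (add_le_add le_rfl (ih hs))

/-- **Mean of a bounded gap functional.**  For integrable `U, L` with `L ≤ U` a.e. and `C ≥ 0`,
`∫ min 1 (max 0 (C (U - L))) dμ ≤ C (∫ U dμ - ∫ L dμ)`. [folklore] -/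
theorem integral_min_one_max_le {X : Type*} [MeasurableSpace X] {μ : Measure X}
    [IsFiniteMeasure μ] {U L : X → ℝ} (hU : Integrable U μ) (hL : Integrable L μ)
    (hle : ∀ᵐ S ∂μ, L S ≤ U S) {C : ℝ} (hC : 0 ≤ C) :
    ∫ S, min 1 (max 0 (C * (U S - L S))) ∂μ ≤ C * (∫ S, U S ∂μ - ∫ S, L S ∂μ) := by
  rw [← integral_sub hU hL, ← integral_const_mul]
  have hcont : Continuous fun t : ℝ => min 1 (max 0 (C * t)) :=
    continuous_const.min (continuous_const.max (continuous_const.mul continuous_id))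
  refine integral_mono_ae ?_ ((hU.sub hL).const_mul C) ?_
  · refine Integrable.of_bound
      (hcont.comp_aestronglyMeasurable (hU.sub hL).aestronglyMeasurable) 1
      (ae_of_all _ fun S => ?_)
    simp only [Real.norm_eq_abs]
    rw [abs_of_nonneg (le_min zero_le_one (le_max_left _ _))]
    exact min_le_left _ _
  · filter_upwards [hle] with S hS
    have h0 : 0 ≤ C * (U S - L S) := mul_nonneg hC (sub_nonneg.2 hS)
    rw [max_eq_right h0]
    exact min_le_right _ _

/-! ### Continuity points of right-regularised antitone means -/

/-- The right regularisation `ε ↦ ⨆_{q ∈ ℚ, ε < q, 0 < q} m q` of any `m : ℝ → ℝ≥0∞` is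
antitone. [folklore] -/
theorem antitone_iSup_rat_gt (m : ℝ → ℝ≥0∞) :
    Antitone fun ε : ℝ => ⨆ q : {q : ℚ // ε < q ∧ 0 < (q : ℝ)}, m q := fun ε _ hle =>
  iSup_le fun q => le_iSup (fun q : {q : ℚ // ε < q ∧ 0 < (q : ℝ)} => m q)
    ⟨q.1, hle.trans_lt q.2.1, q.2.2⟩

/-- **Small gaps at continuity points.**  Let `m : ℝ → ℝ≥0∞` be antitone and finite along the
positive rationals, and let `ε₀ > 0` be a continuity point of the right regularisation
`ε ↦ ⨆_{q ∈ ℚ, ε < q, 0 < q} m q`.  Then for every `η > 0` there are rationals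
`0 < q' < ε₀ < q` with `m q' - m q < η`. [folklore] -/
theorem exists_rat_tsub_lt_of_continuousAt {m : ℝ → ℝ≥0∞}
    (hanti : ∀ q q' : ℚ, 0 < (q' : ℝ) → q' ≤ q → m q ≤ m q')
    (hfin : ∀ q : ℚ, 0 < (q : ℝ) → m q ≠ ⊤) {ε₀ : ℝ} (hε₀ : 0 < ε₀)
    (hc : ContinuousAt (fun ε : ℝ => ⨆ q : {q : ℚ // ε < q ∧ 0 < (q : ℝ)}, m q) ε₀)
    {η : ℝ≥0∞} (hη : 0 < η) :
    ∃ q q' : ℚ, 0 < (q' : ℝ) ∧ (q' : ℝ) < ε₀ ∧ ε₀ < q ∧ m q' - m q < η := by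
  set h : ℝ → ℝ≥0∞ := fun ε => ⨆ q : {q : ℚ // ε < q ∧ 0 < (q : ℝ)}, m q with hh
  -- `h q ≤ m q` for positive rationals, `m q ≤ h x` for `x < q`
  have hq_le : ∀ q : ℚ, 0 < (q : ℝ) → h q ≤ m q := fun q hq =>
    iSup_le fun r => hanti r q hq (by exact_mod_cast r.2.1.le)
  have le_h : ∀ (x : ℝ) (q : ℚ), x < q → 0 < (q : ℝ) → m q ≤ h x := fun x q hxq hq =>
    le_iSup (fun r : {r : ℚ // x < r ∧ 0 < (r : ℝ)} => m r) ⟨q, hxq, hq⟩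
  -- `h ε₀ < ⊤`
  have hfin₀ : h ε₀ ≠ ⊤ := by
    obtain ⟨q₀, hq₀0, hq₀ε⟩ := exists_rat_btwn hε₀
    refine ne_top_of_le_ne_top (hfin q₀ hq₀0) (iSup_le fun r => hanti r q₀ hq₀0 ?_)
    exact_mod_cast (hq₀ε.trans r.2.1).le
  -- continuity: `h x - h y → 0` as `(x, y) → (ε₀, ε₀)`
  have hT : Tendsto (fun p : ℝ × ℝ => h p.1 - h p.2) (𝓝 (ε₀, ε₀)) (𝓝 (h ε₀ - h ε₀)) :=
    ENNReal.Tendsto.sub (hc.tendsto.comp (continuous_fst.tendsto (ε₀, ε₀)))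
      (hc.tendsto.comp (continuous_snd.tendsto (ε₀, ε₀))) (Or.inl hfin₀)
  rw [tsub_self] at hT
  obtain ⟨r, hr, hball⟩ := Metric.eventually_nhds_iff.1 (hT.eventually (gt_mem_nhds hη))
  -- the points
  set x : ℝ := max (ε₀ - r / 2) (ε₀ / 2) with hx
  have hxε : x < ε₀ := max_lt (by linarith) (by linarith)
  have hx0 : 0 < x := lt_max_of_lt_right (by linarith)
  obtain ⟨q', hxq', hq'ε⟩ := exists_rat_btwn hxε
  obtain ⟨q, hεq, hqr⟩ := exists_rat_btwn (show ε₀ < ε₀ + r / 2 by linarith)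
  have hq'0 : 0 < (q' : ℝ) := hx0.trans hxq'
  have hq0 : 0 < (q : ℝ) := hε₀.trans hεq
  have hdist : dist (x, (q : ℝ)) (ε₀, ε₀) < r := by
    rw [Prod.dist_eq, Real.dist_eq, Real.dist_eq]
    refine max_lt (abs_sub_lt_iff.2 ⟨by linarith, ?_⟩) (abs_sub_lt_iff.2 ⟨by linarith, by linarith⟩)
    have : ε₀ - r / 2 ≤ x := le_max_left _ _
    linarith
  have hlt : h x - h q < η := hball hdist
  refine ⟨q, q', hq'0, hq'ε, hεq, lt_of_le_of_lt ?_ hlt⟩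
  exact tsub_le_tsub (le_h x q' hxq' hq'0) (hq_le q hq0)


/-- **The kernels of a joint graph limit are almost surely antitone in the cutoff** — the
registered helper headline of this file in closed form; see `ae_kernel_le_of_graphLimit`.
[folklore] -/
theorem nodeN1e_aeAntitone :
    (∀ ε : ℝ, 0 < ε → ∀ φ : ℂ → ℝ, Continuous φ → HasCompactSupport φ → ∃ C δ₀ : ℝ, 0 < δ₀ ∧
      ∀ δ : ℝ, 0 < δ → δ ≤ δ₀ → ∫ ω, (∫ x,
      |φ x| ∂(z2PivotalMeasure ε δ ω)) ^ 2 ∂(bondPercolation (zdGraph 2) half) ≤ C) →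
      ∀ (μ : FiniteMeasure (QuadConfig (Set.univ : Set ℂ))),
      IsProbabilityMeasure (μ : Measure (QuadConfig (Set.univ : Set ℂ))) → ∀ (δs : ℕ → ℝ), (∀ k,
      0 < δs k) → Tendsto δs atTop (𝓝 0) → ∀ (𝓓 : Set (CompactlySupportedContinuousMap ℂ ℝ)),
      (∀ K : Set ℂ, IsCompact K → ∃ χ ∈ 𝓓, (∀ x, χ x ∈ Set.Icc (0 : ℝ) 1) ∧ (∀ x ∈ K, χ x = 1) ∧
      ∀ f : CompactlySupportedContinuousMap ℂ ℝ, Function.support f ⊆ K → ∀ η : ℝ, 0 < η →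
      ∃ g ∈ 𝓓, ∀ x, |f x - g x| ≤ η * χ x) → ∀ (A : Set ℝ), (∀ ε ∈ A, 0 < ε) → ∀ (M : ℝ →
      QuadConfig (Set.univ : Set ℂ) → Measure ℂ), (∀ ε, Measurable (M ε)) → (∀ ε S,
      IsFiniteMeasureOnCompacts (M ε S)) → (∀ ε ∈ A, ∀ r : ℝ, ∫⁻ S,
      M ε S (Metric.closedBall 0 r) ∂(μ : Measure (QuadConfig (Set.univ : Set ℂ))) < ⊤) →
      (∀ G : BoundedContinuousFunction (QuadConfig (Set.univ : Set ℂ) × (A × 𝓓 → ℝ)) ℝ,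
      Tendsto (fun k => ∫ ω, G (z2QuadConfig (Set.univ : Set ℂ) (δs k) ω, fun p => ∫ x,
      (p.2 : CompactlySupportedContinuousMap ℂ ℝ) x ∂(z2PivotalMeasure (p.1 : ℝ) (δs k) ω))
      ∂(bondPercolation (zdGraph 2) half)) atTop (𝓝 (∫ S, G (S, fun p => ∫ x,
      (p.2 : CompactlySupportedContinuousMap ℂ ℝ) x ∂(M (p.1 : ℝ) S)) ∂(μ : Measure (QuadConfig
      (Set.univ : Set ℂ)))))) → ∀ (ε ε' : ℝ), ε ∈ A → ε' ∈ A → ε' ≤ ε →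
      ∀ᵐ S ∂(μ : Measure (QuadConfig (Set.univ : Set ℂ))), M ε S ≤ M ε' S := by
  intro hmom μ hμP δs hpos h0 𝓓 hdense A hApos M hMm hMfin hMint hG ε ε' hε hε' hle
  haveI := hμP
  exact ae_kernel_le_of_graphLimit hmom μ hpos h0 hdense hApos hMm hMfin hMint hG hε hε' hle

end Summit.CriticalPhenomena.CardyFormulaZ2.Theorems.CardyMeckeFlip

end
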